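import Literature.RingTheory.Derivation.RegularFoliationQuotientProof
import HarnessLib

/-!
# Iterated slices: the common constants of COMMUTING nilpotent derivations with a dual family
# (Matsumura's Ex. 25.5 iterated; the «rank `r`» normal-form case of Posva's Lemma 2.37 ⇐)

Topic: `Literature/RingTheory/Derivation`; sibling of `SliceDecomposition.lean` (one derivation with a
slice: `A = ⊕_{i<p} A₀ xⁱ`, Matsumura Ex. 25.5) and of `RegularFoliationQuotientProof.lean` (rank one:
the ring of constants of a regular local ring along a slice is regular local, Matsumura Thm. 23.7 (i)).

SETTING. `A` a commutative ring of prime characteristic `p`; a finite family `D : Fin r → Der_ℤ(A)` of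
PAIRWISE COMMUTING derivations (`Dᵢ (Dⱼ a) = Dⱼ (Dᵢ a)`) which are `p`-NILPOTENT (`Dᵢ^[p] = 0`) and admit
a DUAL family `y : Fin r → A` (`Dᵢ yⱼ = δᵢⱼ`); `B` the ring of common constants
`{c | ∀ i, Dᵢ c = 0}` — given either as a subring of `A` (`§4`) or, for the induction, as an injective
algebra `B → A` with that range (`§2–§3`).

RESULTS.
* `free_and_finrank_of_slice` (§1, rank one, algebra form of the tree's
  `Posva2023_Lemma_2_37_rank1.free`): `A` is free of rank `p` over the constants of ONE nilpotent
  derivation with a slice;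
* `free_and_finrank_of_commuting_slices` (§2): `A` is a FREE `B`-module of rank `p ^ r` — induction on
  `r`: the constants `B₁` of `D₁, …, D_{r}` are free under `A` of rank `p ^ r` (induction hypothesis IN
  the ring `A`), `D₀` restricts to `B₁` (commutation) with slice `y₀ ∈ B₁` and constants `B`, so `B₁`
  is free of rank `p` over `B` (§1 in the ring `B₁`), and bases multiply (`Module.Basis.smulTower`);
* §3 descents along `B → A` (units reflect; faithful flatness): `B` is local, Noetherian, the map is a
  local homomorphism, and — Matsumura Thm. 23.7 (i), tree `IsRegularLocalRing.of_flat_of_isLocalHom` —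
  **`B` is a regular local ring when `A` is** (`isRegularLocalRing_of_commuting_slices`);
* §4 the subring forms (`B : Subring A`, `∀ c, c ∈ B ↔ ∀ i, Dᵢ c = 0`), in the shape of the named fact
  `Posva2023_Lemma_2_37_rank1`: `free_of_commuting_slices`, `finrank_eq_pow_of_commuting_slices`,
  `isRegularLocalRing_and_free_of_commuting_slices`; §5 the `k`-subalgebra forms

This is the Seshadri–Yuan normal form of a regular `1`-foliation of rank `r` (`𝓕 = ⊕ A·Dᵢ` with
commuting `p`-nilpotent `Dᵢ` dual to part of a system of coordinates), for which Posva's Lemma 2.37 ⇐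
(`A^𝓕` regular) is the statement of §3/§4; it answers the «rank `r`» part of the `TODO(general form)`
of `RegularFoliationQuotient.lean` IN NORMAL FORM (the reduction of a general regular `1`-foliation to
normal form, Posva Lemma 2.18, is not formalised here). Consumer (cell res-hironaka, rung L W4.1, crux
`Steer` stmt-16345, stub `stub_logExit` E1 half, res-L0-w41-idea-2's PLAN-LogFinalExitM §1 L3
`stub_constantsIterate`): the content frame `D₂, …, D_n` of L1 is such a family on the regular local
ring `S`, so `S^𝓕` is regular local and `S` is free over it of rank `p^{n-1}`.

References: H. Matsumura, *Commutative Ring Theory*, CUP 1986, §25 Ex. 25.5, Thm. 23.7 (i), Thm. 7.5;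
Q. Posva, Nagoya Math. J. 261 (2026) e6, Lemma 2.37 / Lemma 2.18. Elementary over the two sibling files;
no definitions, no named facts. Formalisation OURS (AI-produced; weaker than expert review).
-/

noncomputable section

open IsLocalRing

namespace Literature.RingTheory.Derivation

namespace IteratedSlice

universe u

/-! ## §0 Restricting a derivation to a subring it preserves -/

/-- A `ℤ`-derivation of `A` preserving a subring `S` restricts to a `ℤ`-derivation of `S` (existence
form; the restriction is determined by `((δ' c : S) : A) = δ c`).
[cite: Matsumura1987, §25 (derivations; restriction to an invariant subring)] -/
theorem exists_derivation_restrict {A : Type*} [CommRing A] (δ : _root_.Derivation ℤ A A)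
    (S : Subring A) (hS : ∀ c ∈ S, δ c ∈ S) :
    ∃ δ' : _root_.Derivation ℤ S S, ∀ c : S, ((δ' c : S) : A) = δ c := by
  let φ : S →+ S :=
    { toFun := fun c => ⟨δ c, hS c c.2⟩
      map_zero' := Subtype.ext (by simp)
      map_add' := fun a b => Subtype.ext (by simp) }
  refine ⟨_root_.Derivation.mk' φ.toIntLinearMap fun a b => Subtype.ext ?_, fun c => rfl⟩
  change δ ((a : A) * b) = ((a * ⟨δ b, hS b b.2⟩ + b * ⟨δ a, hS a a.2⟩ : S) : A)
  rw [δ.leibniz, smul_eq_mul, smul_eq_mul]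
  rfl

/-- Iterates of a restricted derivation are the restricted iterates.
[cite: Matsumura1987, §25 (derivations; restriction to an invariant subring)] -/
theorem coe_iterate_eq {A : Type*} [CommRing A] {S : Subring A} (δ' : _root_.Derivation ℤ S S)
    (δ : _root_.Derivation ℤ A A) (h : ∀ c : S, ((δ' c : S) : A) = δ c) (n : ℕ) (c : S) :
    (((⇑δ')^[n] c : S) : A) = (⇑δ)^[n] (c : A) := by
  induction n generalizing c with
  | zero => rfl
  | succ n ih => rw [Function.iterate_succ_apply', Function.iterate_succ_apply', h, ih]

/-! ## §1 Rank one, algebra form: `A` is free of rank `p` over the constants of one slice -/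

/-- **Rank one (Matsumura Ex. 25.5), algebra form.** Let `δ` be a derivation of a commutative ring `A`
of prime characteristic `p` with `δ^[p] = 0` and a slice `δ x = 1`, and let `B → A` be an INJECTIVE
algebra whose range is the ring of constants `{c | δ c = 0}`. Then `A` is a free `B`-module of rank `p`
(basis `1, x, …, x^{p-1}`). [cite: Matsumura1987, §25 Exercise 25.5] -/
theorem free_and_finrank_of_slice {A B : Type*} [CommRing A] [CommRing B] [Algebra B A]
    (p : ℕ) [Fact p.Prime] [CharP A p] [Nontrivial A] (δ : _root_.Derivation ℤ A A) {x : A}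
    (hx : δ x = 1) (hδp : ∀ a : A, (⇑δ)^[p] a = 0) (hinj : Function.Injective (algebraMap B A))
    (hB : ∀ c : A, c ∈ Set.range (algebraMap B A) ↔ δ c = 0) :
    Module.Free B A ∧ Module.finrank B A = p := by
  classical
  haveI : Nontrivial B := (algebraMap B A).domain_nontrivial
  have hli : LinearIndependent B (fun i : Fin p => x ^ (i : ℕ)) := by
    rw [Fintype.linearIndependent_iff]
    intro g hg i
    simp only [Algebra.smul_def] at hg
    obtain ⟨c, -, huniq⟩ := existsUnique_fin_sum_mul_pow δ p hx hδp (0 : A)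
    have h1 := huniq (fun i => algebraMap B A (g i)) ⟨fun i => (hB _).mp ⟨g i, rfl⟩, hg.symm⟩
    have h0 := huniq (fun _ => (0 : A)) ⟨fun _ => map_zero δ, by simp⟩
    have hgi : algebraMap B A (g i) = 0 := by
      have := congrFun (h1.trans h0.symm) i
      simpa using this
    exact hinj (by rw [hgi, map_zero])
  have hsp : ⊤ ≤ Submodule.span B (Set.range fun i : Fin p => x ^ (i : ℕ)) := by
    intro a _
    obtain ⟨c, ⟨hc, hca⟩, -⟩ := existsUnique_fin_sum_mul_pow δ p hx hδp a
    rw [hca]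
    refine Submodule.sum_mem _ fun i _ => ?_
    obtain ⟨b, hb⟩ := (hB _).mpr (hc i)
    rw [← hb, ← Algebra.smul_def]
    exact Submodule.smul_mem _ _ (Submodule.subset_span ⟨i, rfl⟩)
  let basis : Module.Basis (Fin p) B A := Module.Basis.mk hli hsp
  exact ⟨Module.Free.of_basis basis, by rw [Module.finrank_eq_card_basis basis, Fintype.card_fin]⟩

/-! ## §2 Rank `r`: `A` is free of rank `p ^ r` over the common constants (induction on `r`) -/

/-- **Iterated slices, algebra form.** `A` a commutative ring of prime characteristic `p`, `D : Fin r →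
Der_ℤ(A)` pairwise commuting, `p`-nilpotent, with a dual family `y` (`Dᵢ yⱼ = δᵢⱼ`), and `B → A` an
injective algebra whose range is the ring of common constants. Then `A` is a free `B`-module of rank
`p ^ r`. Induction on `r`: the constants `B₁` of `D₁, …` carry the restriction of `D₀` (commutation)
with slice `y₀` and constants `B`, so `[A : B] = [A : B₁]·[B₁ : B] = p^{r}·p`.
[cite: Matsumura1987, §25 Exercise 25.5] -/
theorem free_and_finrank_of_commuting_slices (p : ℕ) [Fact p.Prime] (r : ℕ) :
    ∀ (A B : Type u) [CommRing A] [CommRing B] [Algebra B A] [CharP A p] [Nontrivial A]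
      (D : Fin r → _root_.Derivation ℤ A A) (y : Fin r → A),
      (∀ i j (a : A), D i (D j a) = D j (D i a)) → (∀ i (a : A), (⇑(D i))^[p] a = 0) →
      (∀ i j, D i (y j) = if i = j then 1 else 0) →
      Function.Injective (algebraMap B A) →
      (∀ c : A, c ∈ Set.range (algebraMap B A) ↔ ∀ i, D i c = 0) →
      Module.Free B A ∧ Module.finrank B A = p ^ r := by
  induction r with
  | zero =>
    intro A B _ _ _ _ _ D y _ _ _ hinj hB
    haveI : Nontrivial B := (algebraMap B A).domain_nontrivial
    -- no derivation: `B → A` is bijective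
    have hsurj : Function.Surjective (algebraMap B A) := fun c =>
      (hB c).mpr fun i => Fin.elim0 i
    let e : B ≃ₗ[B] A := LinearEquiv.ofBijective (Algebra.linearMap B A) ⟨hinj, hsurj⟩
    exact ⟨Module.Free.of_equiv e, by rw [← e.finrank_eq, Module.finrank_self, pow_zero]⟩
  | succ r IH =>
    intro A B _ _ _ _ _ D y hcomm hnil hdual hinj hB
    classical
    haveI : Nontrivial B := (algebraMap B A).domain_nontrivial
    -- ### the common constants `B₁` of the LAST `r` derivations `D 1, …, D r`
    let B₁ : Subring A :=
      { carrier := {c | ∀ i : Fin r, D i.succ c = 0}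
        mul_mem' := fun {a b} ha hb i => by
          rw [_root_.Derivation.leibniz, ha i, hb i, smul_zero, smul_zero, add_zero]
        one_mem' := fun i => by simp
        add_mem' := fun {a b} ha hb i => by rw [map_add, ha i, hb i, add_zero]
        zero_mem' := fun i => by simp
        neg_mem' := fun {a} ha i => by rw [map_neg, ha i, neg_zero] }
    have hmemB₁ : ∀ c : A, c ∈ B₁ ↔ ∀ i : Fin r, D i.succ c = 0 := fun c => Iff.rfl
    -- `A` is free of rank `p ^ r` over `B₁` (induction hypothesis in the ring `A`)
    obtain ⟨hfree₁, hrank₁⟩ := IH A B₁ (fun i => D i.succ) (fun i => y i.succ)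
      (fun i j a => hcomm i.succ j.succ a) (fun i a => hnil i.succ a)
      (fun i j => by simpa only [Fin.succ_inj] using hdual i.succ j.succ)
      Subtype.val_injective
      (fun c => ⟨fun ⟨b, hb⟩ => hb ▸ b.2, fun h => ⟨⟨c, h⟩, rfl⟩⟩)
    -- ### `D 0` restricts to `B₁` (the family commutes), with slice `y 0 ∈ B₁` and constants `B`
    have hpres : ∀ c ∈ B₁, D 0 c ∈ B₁ := fun c hc i => by
      show D i.succ (D 0 c) = 0
      rw [hcomm, (hmemB₁ c).mp hc i, map_zero]
    obtain ⟨δ, hδ⟩ := exists_derivation_restrict (D 0) B₁ hpres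
    have hy0 : y 0 ∈ B₁ := fun i => by
      rw [hdual]
      exact if_neg (Fin.succ_ne_zero i)
    have hδy : δ ⟨y 0, hy0⟩ = 1 := Subtype.ext (by rw [hδ]; simpa using hdual 0 0)
    have hδp : ∀ c : B₁, (⇑δ)^[p] c = 0 := fun c =>
      Subtype.ext (by rw [coe_iterate_eq δ (D 0) hδ, hnil]; rfl)
    -- the factorisation `B → B₁ → A`
    have hBB₁ : ∀ b : B, algebraMap B A b ∈ B₁ := fun b i => ((hB _).mp ⟨b, rfl⟩) i.succ
    letI : Algebra B B₁ := ((algebraMap B A).codRestrict B₁ hBB₁).toAlgebra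
    haveI : IsScalarTower B B₁ A := IsScalarTower.of_algebraMap_eq fun _ => rfl
    have hinj₁ : Function.Injective (algebraMap B B₁) := fun b b' h =>
      hinj (congrArg Subtype.val h)
    have hBδ : ∀ c : B₁, c ∈ Set.range (algebraMap B B₁) ↔ δ c = 0 := by
      intro c
      constructor
      · rintro ⟨b, rfl⟩
        exact Subtype.ext (by rw [hδ]; exact ((hB _).mp ⟨b, rfl⟩) 0)
      · intro hc
        have hc0 : D 0 (c : A) = 0 := by
          rw [← hδ, hc]
          rfl
        obtain ⟨b, hb⟩ := (hB (c : A)).mpr fun i => by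
          refine Fin.cases ?_ (fun j => ?_) i
          · exact hc0
          · exact c.2 j
        exact ⟨b, Subtype.ext hb⟩
    -- rank one in the ring `B₁`: `B₁` is free of rank `p` over `B`
    obtain ⟨hfree₀, hrank₀⟩ := free_and_finrank_of_slice (A := B₁) (B := B) p δ hδy hδp hinj₁ hBδ
    -- ### bases multiply
    haveI := hfree₀
    haveI := hfree₁
    refine ⟨Module.Free.of_basis
      ((Module.Free.chooseBasis B B₁).smulTower (Module.Free.chooseBasis B₁ A)), ?_⟩
    rw [← Module.finrank_mul_finrank B B₁ A, hrank₀, hrank₁, pow_succ']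

/-! ## §3 Descents along `B → A`: units, locality, Noetherianity, regularity -/

section Descent

variable {A B : Type u} [CommRing A] [CommRing B] [Algebra B A] {r : ℕ}
  (D : Fin r → _root_.Derivation ℤ A A) (hinj : Function.Injective (algebraMap B A))
  (hB : ∀ c : A, c ∈ Set.range (algebraMap B A) ↔ ∀ i, D i c = 0)

include hinj hB

/-- A common constant which is a unit of `A` is a unit of `B`: the inverse of a constant is a constant
(`D(v⁻¹) = -v⁻² D v`). [cite: Matsumura1987, §25 (derivations; Leibniz rule for inverses)] -/
theorem isUnit_of_isUnit_algebraMap {b : B} (h : IsUnit (algebraMap B A b)) : IsUnit b := by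
  have hinv : ∀ i, D i (↑h.unit⁻¹ : A) = 0 := fun i => by
    rw [(D i).leibniz_of_mul_eq_one (Units.inv_mul h.unit), h.unit_spec, ((hB _).mp ⟨b, rfl⟩) i,
      smul_zero]
  obtain ⟨b', hb'⟩ := (hB _).mpr hinv
  refine IsUnit.of_mul_eq_one b' (hinj ?_)
  rw [map_mul, hb', map_one]
  exact h.mul_val_inv

/-- The ring of common constants of a local ring is local (plumbing for the regularity descent; the
rank-one subring form is `Posva2023_Lemma_2_37_rank1.isLocalRing`). [folklore] -/
private theorem isLocalRing_of_constants [IsLocalRing A] : IsLocalRing B := by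
  haveI : Nontrivial B := (algebraMap B A).domain_nontrivial
  refine IsLocalRing.of_isUnit_or_isUnit_one_sub_self fun b => ?_
  rcases IsLocalRing.isUnit_or_isUnit_one_sub_self (algebraMap B A b) with h | h
  · exact Or.inl (isUnit_of_isUnit_algebraMap D hinj hB h)
  · refine Or.inr (isUnit_of_isUnit_algebraMap D hinj hB ?_)
    rwa [map_sub, map_one]

/-- `B → A` is a local homomorphism (plumbing; rank-one subring form is
`Posva2023_Lemma_2_37_rank1.isLocalHom`). [folklore] -/
private theorem isLocalHom_of_constants : IsLocalHom (algebraMap B A) :=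
  ⟨fun _ h => isUnit_of_isUnit_algebraMap D hinj hB h⟩

omit hinj hB in
/-- **Noetherian descent**: if `A` is Noetherian, non-trivial and free over `B`, then `B` is Noetherian
(faithful flatness: `Ideal.map` is injective, so the chain condition descends).
[cite: Matsumura1987, Thm. 7.5 with §25 Ex. 25.5] -/
theorem isNoetherianRing_of_free [Nontrivial A] [IsNoetherianRing A] [Module.Free B A] :
    IsNoetherianRing B := by
  haveI : Module.FaithfullyFlat B A := inferInstance
  have hmono : StrictMono (Ideal.map (algebraMap B A)) :=
    Monotone.strictMono_of_injective (f := Ideal.map (algebraMap B A)) (fun _ _ h => Ideal.map_mono h)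
      Ideal.map_injective_of_faithfullyFlat
  haveI : WellFoundedGT (Ideal A) := isNoetherian_iff'.mp ‹IsNoetherianRing A›
  exact isNoetherian_iff'.mpr hmono.wellFoundedGT

/-- **The ring of common constants of a regular local ring along commuting slices is regular local**
(algebra form): `B → A` is a flat local homomorphism of Noetherian local rings with `A` regular
(Matsumura Thm. 23.7 (i), tree `IsRegularLocalRing.of_flat_of_isLocalHom`). [cite: Matsumura1987,
Thm. 23.7 (i) with §25 Ex. 25.5] [cite: Posva2023, Lemma 2.37 (⇐) with Lemma 2.18] -/
theorem isRegularLocalRing_of_commuting_slices (p : ℕ) [Fact p.Prime] [CharP A p]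
    [IsRegularLocalRing A] (y : Fin r → A) (hcomm : ∀ i j (a : A), D i (D j a) = D j (D i a))
    (hnil : ∀ i (a : A), (⇑(D i))^[p] a = 0) (hdual : ∀ i j, D i (y j) = if i = j then 1 else 0) :
    IsRegularLocalRing B := by
  haveI : Module.Free B A :=
    (free_and_finrank_of_commuting_slices p r A B D y hcomm hnil hdual hinj hB).1
  haveI : IsLocalRing B := isLocalRing_of_constants D hinj hB
  haveI : IsNoetherianRing B := isNoetherianRing_of_free (A := A) (B := B)
  haveI : IsLocalHom (algebraMap B A) := isLocalHom_of_constants D hinj hB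
  exact Literature.AlgebraicGeometry.Resolution.IsRegularLocalRing.of_flat_of_isLocalHom B A

end Descent

/-! ## §4 Subring forms (the shape of `Posva2023_Lemma_2_37_rank1`) -/

section SubringForms

variable {A : Type u} [CommRing A] (p : ℕ) [Fact p.Prime] [CharP A p] {r : ℕ}
  (D : Fin r → _root_.Derivation ℤ A A) (y : Fin r → A)
  (hcomm : ∀ i j (a : A), D i (D j a) = D j (D i a)) (hnil : ∀ i (a : A), (⇑(D i))^[p] a = 0)
  (hdual : ∀ i j, D i (y j) = if i = j then 1 else 0)
  (B : Subring A) (hB : ∀ c : A, c ∈ B ↔ ∀ i, D i c = 0)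

include hB in
omit [Fact p.Prime] [CharP A p] in
/-- Range of the inclusion of the subring of common constants (plumbing). [folklore] -/
private theorem mem_range_algebraMap_iff (c : A) : c ∈ Set.range (algebraMap B A) ↔ ∀ i, D i c = 0 :=
  ⟨fun ⟨b, hb⟩ => hb ▸ (hB b).mp b.2, fun h => ⟨⟨c, (hB c).mpr h⟩, rfl⟩⟩

include hcomm hnil hdual hB

/-- **Iterated slices (Matsumura Ex. 25.5, rank `r`).** `A` is a FREE module over the ring `B` of common
constants of `r` commuting `p`-nilpotent derivations with a dual family. [cite: Matsumura1987, §25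
Exercise 25.5] -/
theorem free_of_commuting_slices [Nontrivial A] : Module.Free B A :=
  (free_and_finrank_of_commuting_slices p r A B D y hcomm hnil hdual Subtype.val_injective
    (mem_range_algebraMap_iff D B hB)).1

/-- … of rank `[A : B] = p ^ r`. [cite: Matsumura1987, §25 Exercise 25.5] -/
theorem finrank_eq_pow_of_commuting_slices [Nontrivial A] : Module.finrank B A = p ^ r :=
  (free_and_finrank_of_commuting_slices p r A B D y hcomm hnil hdual Subtype.val_injective
    (mem_range_algebraMap_iff D B hB)).2

/-- **The ring of common constants of a REGULAR LOCAL ring along commuting slices is regular local, and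
the ring is free over it of rank `p ^ r`** (subring form) — the rank-`r` normal-form case of Posva's
Lemma 2.37 ⇐ (`A^𝓕` regular for the `1`-foliation `𝓕 = ⊕ A·Dᵢ`). This is `stub_constantsIterate` (L3)
of the W4.1 plan for `stub_logExit` (E1 half) in general ring form; the three conjuncts separately:
`.1`, `free_of_commuting_slices`, `finrank_eq_pow_of_commuting_slices`. [cite: Matsumura1987, Thm. 23.7
(i) with §25 Ex. 25.5] [cite: Posva2023, Lemma 2.37 (⇐) with Lemma 2.18] -/
theorem isRegularLocalRing_and_free_of_commuting_slices [IsRegularLocalRing A] :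
    IsRegularLocalRing B ∧ Module.Free B A ∧ Module.finrank B A = p ^ r :=
  ⟨isRegularLocalRing_of_commuting_slices D Subtype.val_injective (mem_range_algebraMap_iff D B hB) p y
    hcomm hnil hdual, free_of_commuting_slices p D y hcomm hnil hdual B hB,
    finrank_eq_pow_of_commuting_slices p D y hcomm hnil hdual B hB⟩

omit hcomm hnil hdual in
omit [Fact p.Prime] [CharP A p] in
/-- Bookkeeping for the consumer: an element killed by every `Dᵢ` (e.g. the radicand `f = t ^ p`, or any
`p`-th power) is a common constant. [cite: Posva2023, §2.5.1 (A^p ⊆ A^D)] -/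
theorem mem_of_forall_apply_eq_zero {f : A} (hf : ∀ i, D i f = 0) : f ∈ B := (hB f).mpr hf

omit hcomm hnil hdual in
omit [Fact p.Prime] in
/-- Every `p`-th power is a common constant: `A^p ⊆ B`. [cite: Posva2023, §2.5.1 (A^p ⊆ A^D)] -/
theorem pow_char_mem (a : A) : a ^ p ∈ B :=
  (hB _).mpr fun i => apply_pow_char_eq_zero p (D i) a

end SubringForms

/-! ## §5 Subalgebra forms (the consumer's frame: `A` a `k`-algebra, `B` a `k`-subalgebra) -/

section SubalgebraForms

variable {k : Type*} [CommRing k] {A : Type u} [CommRing A] [Algebra k A] (p : ℕ) [Fact p.Prime]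
  [CharP A p] {r : ℕ} (D : Fin r → _root_.Derivation ℤ A A) (y : Fin r → A)
  (hcomm : ∀ i j (a : A), D i (D j a) = D j (D i a)) (hnil : ∀ i (a : A), (⇑(D i))^[p] a = 0)
  (hdual : ∀ i j, D i (y j) = if i = j then 1 else 0)
  (B : Subalgebra k A) (hB : ∀ c : A, c ∈ B ↔ ∀ i, D i c = 0)

include hB in
omit [Fact p.Prime] [CharP A p] in
/-- Range of the inclusion of the subalgebra of common constants (plumbing). [folklore] -/
private theorem mem_range_algebraMap_subalgebra_iff (c : A) :
    c ∈ Set.range (algebraMap B A) ↔ ∀ i, D i c = 0 :=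
  ⟨fun ⟨b, hb⟩ => hb ▸ (hB b).mp b.2, fun h => ⟨⟨c, (hB c).mpr h⟩, rfl⟩⟩

omit [Fact p.Prime] [CharP A p] in
/-- The inclusion of a subalgebra is injective (plumbing). [folklore] -/
private theorem algebraMap_subalgebra_injective : Function.Injective (algebraMap B A) :=
  fun _ _ h => Subtype.ext h

include hcomm hnil hdual hB

/-- Subalgebra form of `free_of_commuting_slices`: `A` is free over the `k`-subalgebra of common
constants. (No hypothesis «essentially of finite type» is needed anywhere in this file: regularity
descends by flatness, Matsumura Thm. 23.7 (i), not through the named fact `Posva2023_Lemma_2_37_rank1`.)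
[cite: Matsumura1987, §25 Exercise 25.5] -/
theorem free_of_commuting_slices_subalgebra [Nontrivial A] : Module.Free B A :=
  (free_and_finrank_of_commuting_slices p r A B D y hcomm hnil hdual
    (algebraMap_subalgebra_injective B) (mem_range_algebraMap_subalgebra_iff D B hB)).1

/-- Subalgebra form: `[A : B] = p ^ r`. [cite: Matsumura1987, §25 Exercise 25.5] -/
theorem finrank_eq_pow_of_commuting_slices_subalgebra [Nontrivial A] : Module.finrank B A = p ^ r :=
  (free_and_finrank_of_commuting_slices p r A B D y hcomm hnil hdual
    (algebraMap_subalgebra_injective B) (mem_range_algebraMap_subalgebra_iff D B hB)).2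

/-- **Subalgebra form**: the `k`-subalgebra of common constants of a regular local `k`-algebra along `r`
commuting `p`-nilpotent derivations with a dual family is a regular local ring, and `A` is free over it
of rank `p ^ r`. [cite: Matsumura1987, Thm. 23.7 (i) with §25 Ex. 25.5] [cite: Posva2023, Lemma 2.37 (⇐)
with Lemma 2.18] -/
theorem isRegularLocalRing_and_free_of_commuting_slices_subalgebra [IsRegularLocalRing A] :
    IsRegularLocalRing B ∧ Module.Free B A ∧ Module.finrank B A = p ^ r :=
  ⟨isRegularLocalRing_of_commuting_slices D (algebraMap_subalgebra_injective B)
    (mem_range_algebraMap_subalgebra_iff D B hB) p y hcomm hnil hdual,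
    free_of_commuting_slices_subalgebra p D y hcomm hnil hdual B hB,
    finrank_eq_pow_of_commuting_slices_subalgebra p D y hcomm hnil hdual B hB⟩

end SubalgebraForms

/-! ## §6 Ambient forms: `S` a subring of a ring `K`, derivations OF `S`, constants as a subring of `K`
(the frame of the W4.1 consumer: `S = 𝒪` a local ring inside the function field `K`, `B = S ∩ K^p`) -/

section AmbientForms

variable {K : Type u} [CommRing K] (S : Subring K) (p : ℕ) [Fact p.Prime] [CharP K p] {r : ℕ}
  (D : Fin r → _root_.Derivation ℤ S S) (y : Fin r → S)
  (hcomm : ∀ i j (a : S), D i (D j a) = D j (D i a)) (hnil : ∀ i (a : S), (⇑(D i))^[p] a = 0)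
  (hdual : ∀ i j, D i (y j) = if i = j then 1 else 0)
  (B : Subring K) (hB : ∀ x : K, x ∈ B ↔ ∃ hx : x ∈ S, ∀ i, D i ⟨x, hx⟩ = 0)

include hB in
omit [Fact p.Prime] [CharP K p] in
/-- The ambient ring of common constants lies inside `S` (plumbing). [folklore] -/
private theorem le_of_ambient : B ≤ S := fun x hx => ((hB x).mp hx).1

include hB in
omit [Fact p.Prime] [CharP K p] in
/-- An element of `S` killed by every `Dᵢ` is an ambient common constant (e.g. the radicand
`f = t ^ p`). [cite: Posva2023, §2.5.1 (A^p ⊆ A^D)] -/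
theorem coe_mem_ambient_of_forall_apply_eq_zero {f : S} (hf : ∀ i, D i f = 0) : (f : K) ∈ B :=
  (hB _).mpr ⟨f.2, hf⟩

include hB in
omit [Fact p.Prime] in
/-- `p`-th powers of elements of `S` are ambient common constants: `S^p ⊆ B`.
[cite: Posva2023, §2.5.1 (A^p ⊆ A^D)] -/
theorem pow_char_mem_ambient {s : K} (hs : s ∈ S) : s ^ p ∈ B := by
  haveI : CharP S p := S.subtype.charP Subtype.val_injective p
  refine (hB _).mpr ⟨S.pow_mem hs p, fun i => ?_⟩
  have h := apply_pow_char_eq_zero p (D i) ⟨s, hs⟩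
  exact h

include hcomm hnil hdual hB in
/-- **Ambient form of `isRegularLocalRing_and_free_of_commuting_slices`.** For a subring `S` of a ring
`K` of prime characteristic `p`, commuting `p`-nilpotent derivations `Dᵢ` OF `S` with a dual family,
and the subring `B ⊆ K` of those `x ∈ S` killed by every `Dᵢ`: if `S` is a regular local ring, so is
`B` (transport of the subring form along `B ≅ {c ∈ S | ∀ i, Dᵢ c = 0}`); this is the shape
`S, B : Subring K` in which the W4.1 sandwich step consumes the iterated-slice theorem.
[cite: Matsumura1987, Thm. 23.7 (i) with §25 Ex. 25.5] [cite: Posva2023, Lemma 2.37 (⇐) with Lemma 2.18] -/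
theorem isRegularLocalRing_of_commuting_slices_ambient [IsRegularLocalRing S] :
    IsRegularLocalRing B := by
  haveI : CharP S p := S.subtype.charP Subtype.val_injective p
  -- the joint kernel inside `S`
  let B' : Subring S := B.comap S.subtype
  have hB' : ∀ c : S, c ∈ B' ↔ ∀ i, D i c = 0 := fun c => by
    rw [Subring.mem_comap, hB]
    exact ⟨fun ⟨_, h⟩ => h, fun h => ⟨c.2, h⟩⟩
  have hreg' : IsRegularLocalRing B' :=
    (isRegularLocalRing_and_free_of_commuting_slices p D y hcomm hnil hdual B' hB').1
  -- `B' ≅ B`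
  have hmap : B'.map S.subtype = B := by
    ext x
    constructor
    · rintro ⟨c, hc, rfl⟩
      exact Subring.mem_comap.mp hc
    · intro hx
      obtain ⟨hxS, -⟩ := (hB x).mp hx
      exact ⟨⟨x, hxS⟩, Subring.mem_comap.mpr hx, rfl⟩
  exact IsRegularLocalRing.of_ringEquiv
    ((B'.equivMapOfInjective S.subtype Subtype.val_injective).trans (RingEquiv.subringCongr hmap))

end AmbientForms

end IteratedSlice

end Literature.RingTheory.Derivation

end
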